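import Summits.ValiantsHypothesis.ValiantsHypothesis.Theorems.KPlusLogSqLawTropicalBParityCensus

/-!
# Route «KPlusLogSqLaw», crux `TropicalB` (stmt-ValiantsHypothesis-19771) — PARITY BANDS: a second mechanism for HAMILTONIAN quotients
# (orbit budgets) and three new forbidden triples on boards of even size; `(4,5)` is not counting-tight on the exponent bands
# `r ≤ 1/2` and `r ≥ 2`, `r = (d₂−d₁)/(d₃−d₂)` — in particular not on the exponents `(0,6,15,19,·)` of the tight `(4,4)` cell

HONEST FRAMING.  Sequel of the PARITY LAW (`…TropicalBParityLaw` / `…TropicalBParityCensus`, val-sym-trop-p4 g10) by the same seat's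
successor (val-sym-trop-p4 g12, cell `pub-symmetroid`, 2026-08-28; `--supports stmt-ValiantsHypothesis-19771 --as helper`), toward the
registered stubs `stub_tropThin` / `stub_tropFat` of `Cruxes/TropicalB/Lines/birth.lean`.  STRUCTURE laws about unique optima
(`IsDominant`) of an ARBITRARY dominance design plus census corollaries (forbidden histogram triples ⇒ non-tight cells); nothing here
bounds `TropicalB` in its window, and nothing bears on `WeakLifting`, DoorA26 / DoorA34, `MatrixDescartes` (stmt-ValiantsHypothesis-18050)
or VP ≠ VNP.

THE MECHANISM.  g10's `hamiltonian_quotient`: if the LATER of two dominant terms is class-smaller off one column `s`, every invariant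
column set of the quotient `σ₁⁻¹σ₂` must contain `s` (cyclewise exchange law), so the quotient is an `m`-cycle.  Here a second route to the
same conclusion: `hamiltonian_of_budget` — if every PROPER invariant set `T ∋ s` carries a difference and NO exponent gain
(`Σ_T d(later) ≤ Σ_T d(earlier)`), then the orbit of `s` is everything.  For the shapes «constant term versus one-off term» the budget is
affine in `|T|`, so two endpoint inequalities suffice (`hamiltonian_const_oneOff`, `hamiltonian_oneOff_const`).  On a board of EVEN size an
`m`-cycle is odd (`sign_of_hamiltonian_even`), and three pairwise-Hamiltonian dominant terms `A ≺ B ≺ C` are contradictory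
(`α⁻¹γ = (α⁻¹β)(β⁻¹γ)`).  New forbidden triples (classes named by exponent, `d c₀ < d c₁ < d c₂ < d c₃`, any `c₄` above `c₀`):
* `parity_law_concave` — `A = m·{c₂}` ≺ `B = {x} + (m−1)·{c₃}` (`d x < d c₂`, budget `d x + (m−2)·d c₃ ≤ (m−1)·d c₂`) ≺ `C = (m−1)·{c₀} + {·}`;
* `parity_law_convex_rev` — `A = (m−1)·{c₁} + {y}` (`d c₂ < d y`, budget `(m−1)·d c₂ ≤ d y + (m−2)·d c₁`) ≺ `B = m·{c₂}` ≺ `C`;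
* `parity_law_concave_rev` — `A = {y} + (m−1)·{c₃}` (`d c₀ < d y`) ≺ `B = m·{c₂}` ≺ `C` (three g10-type pairs; a shape not covered by
  `parity_law_above`, whose middle term is one-off).
CENSUS (`parity_census_concave`, `_convex_rev`, `_concave_rev`; `n + 2 ≤ multichoose K m` = «not counting-tight»): with
`r = (d c₂ − d c₁)/(d c₃ − d c₂)` and `C = (m−1)·{c₀} + {c₄}` placed last by its slope, even-size cells with five exponent values are not
counting-tight for `r ∈ (1/(m−1), 1/(m−2)]` (convex_rev), `r ∈ [m−2, m−1)` (concave), `r > m−1` (concave_rev) — next to g10's `r < 1/(m−1)`.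
At `m = 4`: every `r ≤ 1/2` or `r ≥ 2` (boundary ties excluded by distinct slopes); e.g. `four_five_not_tight_0_6_15_19_64`: the exponents
`(0,6,15,19)` of the kernel's counting-tight `(4,4)` cell (`census_four_four_exact`) admit NO counting-tight extension by a fifth class of
exponent `64` (or larger).  LOCATED complement (this seat, exp/pmtight.c, value-free relaxation «all pairs satisfy the cyclewise law»): for all
314 order types of `(d₀,…,d₃)` with `d₃ ≤ 45` and a separated fifth exponent, the complete `(4,4)` block followed by `(3)·{c₀}+{c₄}` is
infeasible; outside the parity bands (`1/2 < r < 2`) the unsatisfiable cores have 5–10 terms and are not parity triples.  [this cell]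
-/

set_option linter.dupNamespace false
set_option autoImplicit false

namespace Summit.ValiantsHypothesis.ValiantsHypothesis.Theorems.KPlusLogSqLaw.ParityLaw

open Summit.ValiantsHypothesis.ValiantsHypothesis.Theorems.MatrixDescartes.Negative
open Summit.ValiantsHypothesis.ValiantsHypothesis.Theorems.LacunarySymmetroidMatrixDescartes.TropicalCensus
open Finset

variable {m K : ℕ}

/-! ### 1. Hamiltonian quotients from orbit budgets -/

/-- **Hamiltonian quotient by ORBIT BUDGET.**  Two unique optima `(σ₁, l₁)` at `θ₁ < θ₂` `(σ₂, l₂)`, a column `s`, `m ≥ 2`.  If every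
proper column set `T ∋ s` invariant under `σ₁⁻¹σ₂` carries a difference of the two terms and no exponent gain (`Σ_T d∘l₂ ≤ Σ_T d∘l₁`),
then `σ₁⁻¹σ₂` moves every column and all columns lie in the cycle of `s` (the cyclewise exchange law forbids the orbit of `s` to be proper).
[this cell] -/
theorem hamiltonian_of_budget (d : Fin K → ℕ) (v ε : Fin m → Fin m → Fin K → ℤ) {θ₁ θ₂ : ℤ} (hθ : θ₁ < θ₂)
    {σ₁ σ₂ : Equiv.Perm (Fin m)} {l₁ l₂ : Fin m → Fin K}
    (h₁ : IsDominant d v ε θ₁ (σ₁, l₁)) (h₂ : IsDominant d v ε θ₂ (σ₂, l₂)) (s : Fin m) (hm : 2 ≤ m)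
    (hbud : ∀ T : Finset (Fin m), (∀ b, (σ₁⁻¹ * σ₂) b ∈ T ↔ b ∈ T) → s ∈ T → T ≠ univ →
      (∃ b ∈ T, σ₁ b ≠ σ₂ b ∨ l₁ b ≠ l₂ b) ∧ ∑ b ∈ T, (d (l₂ b) : ℤ) ≤ ∑ b ∈ T, (d (l₁ b) : ℤ)) :
    (∀ b, (σ₁⁻¹ * σ₂) b ≠ b) ∧ ∀ b, (σ₁⁻¹ * σ₂).SameCycle s b := by
  classical
  set q := σ₁⁻¹ * σ₂ with hq
  -- the orbit of `s` is everything
  have hsame : ∀ b, q.SameCycle s b := by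
    set T₀ : Finset (Fin m) := univ.filter fun y => q.SameCycle s y with hT₀
    have hinv : ∀ b, q b ∈ T₀ ↔ b ∈ T₀ := by
      intro b; simp only [hT₀, Finset.mem_filter, Finset.mem_univ, true_and]
      exact Equiv.Perm.sameCycle_apply_right
    have hsT : s ∈ T₀ := by
      simp only [hT₀, Finset.mem_filter, Finset.mem_univ, true_and]; exact Equiv.Perm.SameCycle.refl _ _
    by_cases huniv : T₀ = univ
    · intro b
      have hb : b ∈ T₀ := huniv ▸ Finset.mem_univ b
      simpa [hT₀] using hb
    · exfalso
      obtain ⟨hdiff, hle⟩ := hbud T₀ hinv hsT huniv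
      have hlaw := sum_d_lt_of_isDominant_invariant d v ε hθ h₁ h₂ T₀ hinv hdiff
      exact absurd hlaw (not_lt.mpr hle)
  -- `s` moves (some other column lies in its cycle), hence every column moves
  have hsmoved : q s ≠ s := by
    intro hfix
    obtain ⟨b, hb⟩ : ∃ b : Fin m, b ≠ s := by
      have : Nontrivial (Fin m) := Fin.nontrivial_iff_two_le.mpr hm
      exact exists_ne s
    obtain ⟨i, hi⟩ := hsame b
    have : (q ^ i) s = s := Equiv.Perm.zpow_apply_eq_self_of_apply_eq_self hfix i
    exact hb (hi.symm.trans this)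
  refine ⟨fun b hb => hsmoved (((hsame b).apply_eq_self_iff).mpr hb), hsame⟩

/-- sign of a permutation of `Fin m` that moves every point and has a single cycle: `−(−1)^m`. [this cell; `Equiv.Perm.IsCycle.sign`] -/
theorem sign_of_hamiltonian {q : Equiv.Perm (Fin m)} (s : Fin m) (hmv : ∀ b, q b ≠ b) (hsame : ∀ b, q.SameCycle s b) :
    Equiv.Perm.sign q = -(-1) ^ m := by
  classical
  have hcyc : q.IsCycle := ⟨s, hmv s, fun y _ => hsame y⟩
  have hsupp : q.support = univ := by
    ext b; simp only [Equiv.Perm.mem_support, Finset.mem_univ, iff_true]; exact hmv b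
  have h := hcyc.sign
  rw [hsupp, Finset.card_univ, Fintype.card_fin] at h
  exact h

/-- … hence `−1` on a board of even size. [this cell] -/
theorem sign_of_hamiltonian_even (heven : Even m) {q : Equiv.Perm (Fin m)} (s : Fin m) (hmv : ∀ b, q b ≠ b)
    (hsame : ∀ b, q.SameCycle s b) : Equiv.Perm.sign q = -1 := by
  rw [sign_of_hamiltonian s hmv hsame, neg_inj]; exact heven.neg_one_pow

/-- sum of a function constant off one point of a finset containing that point. [arithmetic] -/
theorem sum_oneOff {T : Finset (Fin m)} {s : Fin m} (hs : s ∈ T) (f : Fin m → ℤ) (c : ℤ) (hf : ∀ b, b ≠ s → f b = c) :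
    ∑ b ∈ T, f b = f s + ((T.card : ℤ) - 1) * c := by
  classical
  rw [← Finset.add_sum_erase T f hs]
  have : ∑ b ∈ T.erase s, f b = ∑ b ∈ T.erase s, c :=
    Finset.sum_congr rfl fun b hb => hf b (Finset.ne_of_mem_erase hb)
  rw [this, Finset.sum_const, Finset.card_erase_of_mem hs, nsmul_eq_mul]
  push_cast [Nat.cast_sub (Finset.card_pos.mpr ⟨s, hs⟩)]
  ring

/-- **constant term earlier, one-off term later.**  `(σ₁, all columns class `a`)` dominant at `θ₁ < θ₂` `(σ₂, l₂)` with `l₂ = b`-constant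
off the column `s`, `d (l₂ s) < d a` and the budget `d (l₂ s) + (m−2)·d b ≤ (m−1)·d a`: the quotient is Hamiltonian.  (On a proper invariant
`T ∋ s` of size `ℓ` the gain `ℓ·d a − d(l₂ s) − (ℓ−1)·d b` is affine in `ℓ` and non-negative at `ℓ = 1` and `ℓ = m−1`.) [this cell] -/
theorem hamiltonian_const_oneOff (d : Fin K → ℕ) (v ε : Fin m → Fin m → Fin K → ℤ) {θ₁ θ₂ : ℤ} (hθ : θ₁ < θ₂)
    {σ₁ σ₂ : Equiv.Perm (Fin m)} {l₁ l₂ : Fin m → Fin K}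
    (h₁ : IsDominant d v ε θ₁ (σ₁, l₁)) (h₂ : IsDominant d v ε θ₂ (σ₂, l₂)) (s : Fin m) (hm : 2 ≤ m)
    (a b : Fin K) (hl₁ : ∀ x, l₁ x = a) (hl₂ : ∀ x, x ≠ s → l₂ x = b)
    (hsa : d (l₂ s) < d a) (hbudget : (d (l₂ s) : ℤ) + ((m : ℤ) - 2) * d b ≤ ((m : ℤ) - 1) * d a) :
    (∀ x, (σ₁⁻¹ * σ₂) x ≠ x) ∧ ∀ x, (σ₁⁻¹ * σ₂).SameCycle s x := by
  classical
  refine hamiltonian_of_budget d v ε hθ h₁ h₂ s hm fun T hT hs hne => ⟨?_, ?_⟩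
  · refine ⟨s, hs, Or.inr fun h => ?_⟩
    rw [hl₁ s] at h; rw [← h] at hsa; exact lt_irrefl _ hsa
  · have hcard : T.card ≤ m - 1 := by
      have hlt : T.card < (univ : Finset (Fin m)).card :=
        Finset.card_lt_card ⟨Finset.subset_univ T, fun h => hne (Finset.eq_univ_of_forall fun x => h (Finset.mem_univ x))⟩
      rw [Finset.card_univ, Fintype.card_fin] at hlt; omega
    have hpos : 1 ≤ T.card := Finset.card_pos.mpr ⟨s, hs⟩
    rw [sum_oneOff hs (fun x => (d (l₂ x) : ℤ)) (d b) (fun x hx => by rw [hl₂ x hx]),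
      Finset.sum_congr rfl (fun x _ => by rw [hl₁ x] : ∀ x ∈ T, (d (l₁ x) : ℤ) = d a), Finset.sum_const, nsmul_eq_mul]
    -- affine in `ℓ = T.card`: `d(l₂ s) + (ℓ−1) d b ≤ ℓ d a` for `1 ≤ ℓ ≤ m−1`
    have hℓ : ((T.card : ℕ) : ℤ) ≤ (m : ℤ) - 1 := by
      have : T.card + 1 ≤ m := by omega
      have := (Nat.cast_le (α := ℤ)).mpr this; push_cast at this; linarith
    have hℓ1 : (1 : ℤ) ≤ (T.card : ℤ) := by exact_mod_cast hpos
    have hsa' : (d (l₂ s) : ℤ) < d a := by exact_mod_cast hsa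
    rcases le_or_gt (d b : ℤ) (d a) with hba | hab
    · nlinarith
    · nlinarith

/-- **one-off term earlier, constant term later.**  `(σ₁, l₁)` with `l₁ = b`-constant off `s` dominant at `θ₁ < θ₂` `(σ₂, all columns
class a)`, with `d a < d (l₁ s)` and the budget `(m−1)·d a ≤ d (l₁ s) + (m−2)·d b`: the quotient is Hamiltonian. [this cell] -/
theorem hamiltonian_oneOff_const (d : Fin K → ℕ) (v ε : Fin m → Fin m → Fin K → ℤ) {θ₁ θ₂ : ℤ} (hθ : θ₁ < θ₂)
    {σ₁ σ₂ : Equiv.Perm (Fin m)} {l₁ l₂ : Fin m → Fin K}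
    (h₁ : IsDominant d v ε θ₁ (σ₁, l₁)) (h₂ : IsDominant d v ε θ₂ (σ₂, l₂)) (s : Fin m) (hm : 2 ≤ m)
    (a b : Fin K) (hl₂ : ∀ x, l₂ x = a) (hl₁ : ∀ x, x ≠ s → l₁ x = b)
    (hsa : d a < d (l₁ s)) (hbudget : ((m : ℤ) - 1) * d a ≤ (d (l₁ s) : ℤ) + ((m : ℤ) - 2) * d b) :
    (∀ x, (σ₁⁻¹ * σ₂) x ≠ x) ∧ ∀ x, (σ₁⁻¹ * σ₂).SameCycle s x := by
  classical
  refine hamiltonian_of_budget d v ε hθ h₁ h₂ s hm fun T hT hs hne => ⟨?_, ?_⟩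
  · refine ⟨s, hs, Or.inr fun h => ?_⟩
    rw [hl₂ s] at h; rw [h] at hsa; exact lt_irrefl _ hsa
  · have hcard : T.card ≤ m - 1 := by
      have hlt : T.card < (univ : Finset (Fin m)).card :=
        Finset.card_lt_card ⟨Finset.subset_univ T, fun h => hne (Finset.eq_univ_of_forall fun x => h (Finset.mem_univ x))⟩
      rw [Finset.card_univ, Fintype.card_fin] at hlt; omega
    have hpos : 1 ≤ T.card := Finset.card_pos.mpr ⟨s, hs⟩
    rw [sum_oneOff hs (fun x => (d (l₁ x) : ℤ)) (d b) (fun x hx => by rw [hl₁ x hx]),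
      Finset.sum_congr rfl (fun x _ => by rw [hl₂ x] : ∀ x ∈ T, (d (l₂ x) : ℤ) = d a), Finset.sum_const, nsmul_eq_mul]
    have hℓ : ((T.card : ℕ) : ℤ) ≤ (m : ℤ) - 1 := by
      have : T.card + 1 ≤ m := by omega
      have := (Nat.cast_le (α := ℤ)).mpr this; push_cast at this; linarith
    have hℓ1 : (1 : ℤ) ≤ (T.card : ℤ) := by exact_mod_cast hpos
    have hsa' : (d a : ℤ) < d (l₁ s) := by exact_mod_cast hsa
    rcases le_or_gt (d b : ℤ) (d a) with hba | hab
    · nlinarith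
    · nlinarith

/-! ### 2. Three new forbidden triples on boards of even size -/

/-- **PARITY LAW, concave band.**  `m` even, `m ≥ 2`.  No design has dominant `A ≺ B ≺ C` with `A = (α, all c₂)`,
`B = (β, c₃ off the column bs)` where the class `x = lB bs` has `d x < d c₂ < d c₃`... precisely `d x < d c₂`, `d c₀ < d x`, `d c₀ < d c₃` and
the budget `d x + (m−2)·d c₃ ≤ (m−1)·d c₂`, and `C = (γ, c₀ off one column)` with `d c₀ < d c₂`: the quotients `α⁻¹β` (orbit budget),
`α⁻¹γ`, `β⁻¹γ` (later term smaller off one column) are Hamiltonian, hence odd, while `α⁻¹γ = (α⁻¹β)(β⁻¹γ)`. [this cell] -/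
theorem parity_law_concave (heven : Even m) (hm : 2 ≤ m) (d : Fin K → ℕ) (v ε : Fin m → Fin m → Fin K → ℤ)
    (c₀ c₂ c₃ : Fin K) (h02 : d c₀ < d c₂) (h03 : d c₀ < d c₃)
    {α β γ : Equiv.Perm (Fin m)} {lA lB lC : Fin m → Fin K} (bs cs : Fin m)
    (hlA : ∀ b, lA b = c₂) (hlB : ∀ b, b ≠ bs → lB b = c₃) (hx0 : d c₀ < d (lB bs)) (hx2 : d (lB bs) < d c₂)
    (hbudget : (d (lB bs) : ℤ) + ((m : ℤ) - 2) * d c₃ ≤ ((m : ℤ) - 1) * d c₂) (hlC : ∀ b, b ≠ cs → lC b = c₀)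
    {θA θB θC : ℤ} (hAB : θA < θB) (hBC : θB < θC)
    (hA : IsDominant d v ε θA (α, lA)) (hB : IsDominant d v ε θB (β, lB)) (hC : IsDominant d v ε θC (γ, lC)) : False := by
  obtain ⟨mvAB, cyAB⟩ := hamiltonian_const_oneOff d v ε hAB hA hB bs hm c₂ c₃ hlA hlB hx2 hbudget
  have sAB : Equiv.Perm.sign (α⁻¹ * β) = -1 := sign_of_hamiltonian_even heven bs mvAB cyAB
  have sAC : Equiv.Perm.sign (α⁻¹ * γ) = -1 :=
    sign_quotient_of_even heven d v ε (hAB.trans hBC) hA hC cs (fun b hb => by rw [hlC b hb, hlA b]; exact h02) hm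
  have sBC : Equiv.Perm.sign (β⁻¹ * γ) = -1 :=
    sign_quotient_of_even heven d v ε hBC hB hC cs (fun b hb => by
      rw [hlC b hb]
      by_cases h : b = bs
      · rw [h]; exact hx0
      · rw [hlB b h]; exact h03) hm
  have hprod : α⁻¹ * γ = (α⁻¹ * β) * (β⁻¹ * γ) := by group
  rw [hprod, Equiv.Perm.sign_mul, sAB, sBC] at sAC
  exact absurd sAC (by decide)

/-- **PARITY LAW, reversed convex band.**  `m` even, `m ≥ 2`.  No design has dominant `A ≺ B ≺ C` with
`A = (α, c₁ off the column as)`, class `y = lA as` with `d c₂ < d y` and budget `(m−1)·d c₂ ≤ d y + (m−2)·d c₁`, `B = (β, all c₂)`,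
`C = (γ, c₀ off one column)`, where `d c₀ < d c₁` and `d c₀ < d c₂`. [this cell] -/
theorem parity_law_convex_rev (heven : Even m) (hm : 2 ≤ m) (d : Fin K → ℕ) (v ε : Fin m → Fin m → Fin K → ℤ)
    (c₀ c₁ c₂ : Fin K) (h01 : d c₀ < d c₁) (h02 : d c₀ < d c₂)
    {α β γ : Equiv.Perm (Fin m)} {lA lB lC : Fin m → Fin K} (as cs : Fin m)
    (hlA : ∀ b, b ≠ as → lA b = c₁) (hy : d c₂ < d (lA as))
    (hbudget : ((m : ℤ) - 1) * d c₂ ≤ (d (lA as) : ℤ) + ((m : ℤ) - 2) * d c₁)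
    (hlB : ∀ b, lB b = c₂) (hlC : ∀ b, b ≠ cs → lC b = c₀)
    {θA θB θC : ℤ} (hAB : θA < θB) (hBC : θB < θC)
    (hA : IsDominant d v ε θA (α, lA)) (hB : IsDominant d v ε θB (β, lB)) (hC : IsDominant d v ε θC (γ, lC)) : False := by
  obtain ⟨mvAB, cyAB⟩ := hamiltonian_oneOff_const d v ε hAB hA hB as hm c₂ c₁ hlB hlA hy hbudget
  have sAB : Equiv.Perm.sign (α⁻¹ * β) = -1 := sign_of_hamiltonian_even heven as mvAB cyAB
  have sAC : Equiv.Perm.sign (α⁻¹ * γ) = -1 :=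
    sign_quotient_of_even heven d v ε (hAB.trans hBC) hA hC cs (fun b hb => by
      rw [hlC b hb]
      by_cases h : b = as
      · rw [h]; exact h02.trans hy
      · rw [hlA b h]; exact h01) hm
  have sBC : Equiv.Perm.sign (β⁻¹ * γ) = -1 :=
    sign_quotient_of_even heven d v ε hBC hB hC cs (fun b hb => by rw [hlC b hb, hlB b]; exact h02) hm
  have hprod : α⁻¹ * γ = (α⁻¹ * β) * (β⁻¹ * γ) := by group
  rw [hprod, Equiv.Perm.sign_mul, sAB, sBC] at sAC
  exact absurd sAC (by decide)

/-- **PARITY LAW, reversed concave band.**  `m` even, `m ≥ 2`.  No design has dominant `A ≺ B ≺ C` with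
`A = (α, c₃ off the column as)`, `d c₀ < d (lA as)`, `B = (β, all c₂)` with `d c₂ < d c₃`, `C = (γ, c₀ off one column)`, `d c₀ < d c₂`
(three pairs of g10's type: each later term is class-smaller off one column). [this cell] -/
theorem parity_law_concave_rev (heven : Even m) (hm : 2 ≤ m) (d : Fin K → ℕ) (v ε : Fin m → Fin m → Fin K → ℤ)
    (c₀ c₂ c₃ : Fin K) (h02 : d c₀ < d c₂) (h23 : d c₂ < d c₃)
    {α β γ : Equiv.Perm (Fin m)} {lA lB lC : Fin m → Fin K} (as cs : Fin m)
    (hlA : ∀ b, b ≠ as → lA b = c₃) (hy : d c₀ < d (lA as)) (hlB : ∀ b, lB b = c₂) (hlC : ∀ b, b ≠ cs → lC b = c₀)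
    {θA θB θC : ℤ} (hAB : θA < θB) (hBC : θB < θC)
    (hA : IsDominant d v ε θA (α, lA)) (hB : IsDominant d v ε θB (β, lB)) (hC : IsDominant d v ε θC (γ, lC)) : False := by
  have sAB : Equiv.Perm.sign (α⁻¹ * β) = -1 :=
    sign_quotient_of_even heven d v ε hAB hA hB as (fun b hb => by rw [hlB b, hlA b hb]; exact h23) hm
  have sAC : Equiv.Perm.sign (α⁻¹ * γ) = -1 :=
    sign_quotient_of_even heven d v ε (hAB.trans hBC) hA hC cs (fun b hb => by
      rw [hlC b hb]
      by_cases h : b = as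
      · rw [h]; exact hy
      · rw [hlA b h]; exact h02.trans h23) hm
  have sBC : Equiv.Perm.sign (β⁻¹ * γ) = -1 :=
    sign_quotient_of_even heven d v ε hBC hB hC cs (fun b hb => by rw [hlC b hb, hlB b]; exact h02) hm
  have hprod : α⁻¹ * γ = (α⁻¹ * β) * (β⁻¹ * γ) := by group
  rw [hprod, Equiv.Perm.sign_mul, sAB, sBC] at sAC
  exact absurd sAC (by decide)

/-! ### 3. Census: three more bands of non-tight even-size cells with five exponent values -/

section Census

/-- shared bookkeeping: positions and shapes of the three pattern terms in a full chain. -/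
theorem three_pattern_terms (d : Fin K → ℕ) (v ε : Fin m → Fin m → Fin K → ℤ) (hm : 1 ≤ m)
    (MA MB MC : Multiset (Fin K)) (cA : Multiset.card MA = m) (cB : Multiset.card MB = m) (cC : Multiset.card MC = m)
    (hAB : (MA.map fun l => (d l : ℤ)).sum < (MB.map fun l => (d l : ℤ)).sum)
    (hBC : (MB.map fun l => (d l : ℤ)).sum < (MC.map fun l => (d l : ℤ)).sum)
    {n : ℕ} (θ : Fin (n + 1) → ℤ) (p : Fin (n + 1) → Equiv.Perm (Fin m) × (Fin m → Fin K))
    (hθ : StrictMono θ) (hdom : ∀ k, IsDominant d v ε (θ k) (p k)) (hne : ∀ k : Fin n, p k.castSucc ≠ p k.succ)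
    (hn : Nat.multichoose K m ≤ n + 1) :
    ∃ kA kB kC : Fin (n + 1), kA < kB ∧ kB < kC ∧ (classSym (p kA) : Multiset (Fin K)) = MA ∧
      (classSym (p kB) : Multiset (Fin K)) = MB ∧ (classSym (p kC) : Multiset (Fin K)) = MC := by
  have _ := hm
  obtain ⟨hsm, hsurj⟩ := classSym_surjective_of_full d v ε θ p hθ hdom hne hn
  obtain ⟨kA, hkA⟩ := hsurj ⟨MA, cA⟩
  obtain ⟨kB, hkB⟩ := hsurj ⟨MB, cB⟩
  obtain ⟨kC, hkC⟩ := hsurj ⟨MC, cC⟩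
  have hkA' : (classSym (p kA) : Multiset (Fin K)) = MA := congrArg Subtype.val hkA
  have hkB' : (classSym (p kB) : Multiset (Fin K)) = MB := congrArg Subtype.val hkB
  have hkC' : (classSym (p kC) : Multiset (Fin K)) = MC := congrArg Subtype.val hkC
  refine ⟨kA, kB, kC, ?_, ?_, hkA', hkB', hkC'⟩
  · have hs : slope d (p kA) < slope d (p kB) := by rw [slope_eq_of_classSym, slope_eq_of_classSym, hkA', hkB']; exact hAB
    exact hsm.lt_iff_lt.mp hs
  · have hs : slope d (p kB) < slope d (p kC) := by rw [slope_eq_of_classSym, slope_eq_of_classSym, hkB', hkC']; exact hBC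
    exact hsm.lt_iff_lt.mp hs

/-- sum of exponents over `m·{c}`. -/
theorem sumExp_replicate (d : Fin K → ℕ) (c : Fin K) (m : ℕ) :
    ((Multiset.replicate m c).map fun l => (d l : ℤ)).sum = (m : ℤ) * d c := by
  rw [Multiset.map_replicate, Multiset.sum_replicate, nsmul_eq_mul]

/-- sum of exponents over `{c'} + (m−1)·{c}`. -/
theorem sumExp_cons_replicate (d : Fin K → ℕ) (c c' : Fin K) (hm : 1 ≤ m) :
    ((c' ::ₘ Multiset.replicate (m - 1) c).map fun l => (d l : ℤ)).sum = (d c' : ℤ) + ((m : ℤ) - 1) * d c := by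
  rw [Multiset.map_cons, Multiset.sum_cons, Multiset.map_replicate, Multiset.sum_replicate, nsmul_eq_mul]
  push_cast [Nat.cast_sub hm]
  ring

/-- **PARITY CENSUS, concave band.**  `m` even, `m ≥ 2`, five classes with `d c₀ < d c₁ < d c₂ < d c₃`, `d c₀ < d c₄`, the budget
`d c₁ + (m−2)·d c₃ ≤ (m−1)·d c₂` (i.e. `(m−2)(d c₃ − d c₂) ≤ d c₂ − d c₁`) and the pattern slopes ordered
`m·d c₂ < d c₁ + (m−1)·d c₃ < d c₄ + (m−1)·d c₀`: every unsigned dominant chain has `n + 2 ≤ multichoose K m` — the cell is NOT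
counting-tight (the triple `m·{c₂} ≺ {c₁}+(m−1)·{c₃} ≺ (m−1)·{c₀}+{c₄}` of `parity_law_concave` would have to occur). [this cell] -/
theorem parity_census_concave (heven : Even m) (hm : 2 ≤ m) (d : Fin K → ℕ) (v ε : Fin m → Fin m → Fin K → ℤ)
    (c₀ c₁ c₂ c₃ c₄ : Fin K) (h01 : d c₀ < d c₁) (h12 : d c₁ < d c₂) (h23 : d c₂ < d c₃) (h04 : d c₀ < d c₄)
    (hbudget : (d c₁ : ℤ) + ((m : ℤ) - 2) * d c₃ ≤ ((m : ℤ) - 1) * d c₂)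
    (hAB : (m : ℤ) * d c₂ < (d c₁ : ℤ) + ((m : ℤ) - 1) * d c₃)
    (hBC : (d c₁ : ℤ) + ((m : ℤ) - 1) * d c₃ < (d c₄ : ℤ) + ((m : ℤ) - 1) * d c₀)
    {n : ℕ} (θ : Fin (n + 1) → ℤ) (p : Fin (n + 1) → Equiv.Perm (Fin m) × (Fin m → Fin K))
    (hθ : StrictMono θ) (hdom : ∀ k, IsDominant d v ε (θ k) (p k)) (hne : ∀ k : Fin n, p k.castSucc ≠ p k.succ) :
    n + 2 ≤ Nat.multichoose K m := by
  by_contra hlt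
  have hn : Nat.multichoose K m ≤ n + 1 := by omega
  have hm1 : 1 ≤ m := by omega
  obtain ⟨kA, kB, kC, hAB', hBC', hkA, hkB, hkC⟩ := three_pattern_terms d v ε hm1
    (Multiset.replicate m c₂) (c₁ ::ₘ Multiset.replicate (m - 1) c₃) (c₄ ::ₘ Multiset.replicate (m - 1) c₀)
    (Multiset.card_replicate _ _) (by rw [Multiset.card_cons, Multiset.card_replicate]; omega)
    (by rw [Multiset.card_cons, Multiset.card_replicate]; omega)
    (by rw [sumExp_replicate, sumExp_cons_replicate d c₃ c₁ hm1]; exact hAB)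
    (by rw [sumExp_cons_replicate d c₃ c₁ hm1, sumExp_cons_replicate d c₀ c₄ hm1]; exact hBC) θ p hθ hdom hne hn
  have hlA : ∀ b, (p kA).2 b = c₂ := const_of_classSym_replicate hkA
  obtain ⟨bs, hbs, hlB⟩ := oneOff_of_classSym_cons (fun h => (ne_of_lt (h12.trans h23)) (by rw [h])) hkB
  obtain ⟨cs, hcs, hlC⟩ := oneOff_of_classSym_cons (fun h => (ne_of_lt h04) (by rw [h])) hkC
  refine parity_law_concave heven hm d v ε c₀ c₂ c₃ (h01.trans h12) (h01.trans (h12.trans h23)) bs cs hlA hlB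
    (by rw [hbs]; exact h01) (by rw [hbs]; exact h12) (by rw [hbs]; exact hbudget) hlC (hθ hAB') (hθ hBC')
    (hdom kA) (hdom kB) (hdom kC)

/-- **PARITY CENSUS, reversed convex band.**  `m` even, `m ≥ 2`, `d c₀ < d c₁ < d c₂ < d c₃`, `d c₀ < d c₄`, the budget
`(m−1)·d c₂ ≤ d c₃ + (m−2)·d c₁` (i.e. `(m−2)(d c₂ − d c₁) ≤ d c₃ − d c₂`) and slopes `d c₃ + (m−1)·d c₁ < m·d c₂ < d c₄ + (m−1)·d c₀`:
`n + 2 ≤ multichoose K m` (triple `(m−1)·{c₁}+{c₃} ≺ m·{c₂} ≺ (m−1)·{c₀}+{c₄}`, `parity_law_convex_rev`). [this cell] -/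
theorem parity_census_convex_rev (heven : Even m) (hm : 2 ≤ m) (d : Fin K → ℕ) (v ε : Fin m → Fin m → Fin K → ℤ)
    (c₀ c₁ c₂ c₃ c₄ : Fin K) (h01 : d c₀ < d c₁) (h12 : d c₁ < d c₂) (h23 : d c₂ < d c₃) (h04 : d c₀ < d c₄)
    (hbudget : ((m : ℤ) - 1) * d c₂ ≤ (d c₃ : ℤ) + ((m : ℤ) - 2) * d c₁)
    (hAB : (d c₃ : ℤ) + ((m : ℤ) - 1) * d c₁ < (m : ℤ) * d c₂)
    (hBC : (m : ℤ) * d c₂ < (d c₄ : ℤ) + ((m : ℤ) - 1) * d c₀)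
    {n : ℕ} (θ : Fin (n + 1) → ℤ) (p : Fin (n + 1) → Equiv.Perm (Fin m) × (Fin m → Fin K))
    (hθ : StrictMono θ) (hdom : ∀ k, IsDominant d v ε (θ k) (p k)) (hne : ∀ k : Fin n, p k.castSucc ≠ p k.succ) :
    n + 2 ≤ Nat.multichoose K m := by
  by_contra hlt
  have hn : Nat.multichoose K m ≤ n + 1 := by omega
  have hm1 : 1 ≤ m := by omega
  obtain ⟨kA, kB, kC, hAB', hBC', hkA, hkB, hkC⟩ := three_pattern_terms d v ε hm1
    (c₃ ::ₘ Multiset.replicate (m - 1) c₁) (Multiset.replicate m c₂) (c₄ ::ₘ Multiset.replicate (m - 1) c₀)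
    (by rw [Multiset.card_cons, Multiset.card_replicate]; omega) (Multiset.card_replicate _ _)
    (by rw [Multiset.card_cons, Multiset.card_replicate]; omega)
    (by rw [sumExp_replicate, sumExp_cons_replicate d c₁ c₃ hm1]; exact hAB)
    (by rw [sumExp_replicate, sumExp_cons_replicate d c₀ c₄ hm1]; exact hBC) θ p hθ hdom hne hn
  obtain ⟨as, has, hlA⟩ := oneOff_of_classSym_cons (fun h => (ne_of_lt (h12.trans h23)) (by rw [h])) hkA
  have hlB : ∀ b, (p kB).2 b = c₂ := const_of_classSym_replicate hkB
  obtain ⟨cs, hcs, hlC⟩ := oneOff_of_classSym_cons (fun h => (ne_of_lt h04) (by rw [h])) hkC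
  refine parity_law_convex_rev heven hm d v ε c₀ c₁ c₂ h01 (h01.trans h12) as cs hlA (by rw [has]; exact h23)
    (by rw [has]; exact hbudget) hlB hlC (hθ hAB') (hθ hBC') (hdom kA) (hdom kB) (hdom kC)

/-- **PARITY CENSUS, reversed concave band.**  `m` even, `m ≥ 2`, `d c₀ < d c₁ < d c₂ < d c₃`, `d c₀ < d c₄` and slopes
`d c₁ + (m−1)·d c₃ < m·d c₂ < d c₄ + (m−1)·d c₀` (i.e. `d c₂ − d c₁ > (m−1)(d c₃ − d c₂)`, the cheapest class-`c₄` histogram last):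
`n + 2 ≤ multichoose K m` (triple `{c₁}+(m−1)·{c₃} ≺ m·{c₂} ≺ (m−1)·{c₀}+{c₄}`, `parity_law_concave_rev`). [this cell] -/
theorem parity_census_concave_rev (heven : Even m) (hm : 2 ≤ m) (d : Fin K → ℕ) (v ε : Fin m → Fin m → Fin K → ℤ)
    (c₀ c₁ c₂ c₃ c₄ : Fin K) (h01 : d c₀ < d c₁) (h12 : d c₁ < d c₂) (h23 : d c₂ < d c₃) (h04 : d c₀ < d c₄)
    (hAB : (d c₁ : ℤ) + ((m : ℤ) - 1) * d c₃ < (m : ℤ) * d c₂)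
    (hBC : (m : ℤ) * d c₂ < (d c₄ : ℤ) + ((m : ℤ) - 1) * d c₀)
    {n : ℕ} (θ : Fin (n + 1) → ℤ) (p : Fin (n + 1) → Equiv.Perm (Fin m) × (Fin m → Fin K))
    (hθ : StrictMono θ) (hdom : ∀ k, IsDominant d v ε (θ k) (p k)) (hne : ∀ k : Fin n, p k.castSucc ≠ p k.succ) :
    n + 2 ≤ Nat.multichoose K m := by
  by_contra hlt
  have hn : Nat.multichoose K m ≤ n + 1 := by omega
  have hm1 : 1 ≤ m := by omega
  obtain ⟨kA, kB, kC, hAB', hBC', hkA, hkB, hkC⟩ := three_pattern_terms d v ε hm1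
    (c₁ ::ₘ Multiset.replicate (m - 1) c₃) (Multiset.replicate m c₂) (c₄ ::ₘ Multiset.replicate (m - 1) c₀)
    (by rw [Multiset.card_cons, Multiset.card_replicate]; omega) (Multiset.card_replicate _ _)
    (by rw [Multiset.card_cons, Multiset.card_replicate]; omega)
    (by rw [sumExp_replicate, sumExp_cons_replicate d c₃ c₁ hm1]; exact hAB)
    (by rw [sumExp_replicate, sumExp_cons_replicate d c₀ c₄ hm1]; exact hBC) θ p hθ hdom hne hn
  obtain ⟨as, has, hlA⟩ := oneOff_of_classSym_cons (fun h => (ne_of_lt (h12.trans h23)) (by rw [h])) hkA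
  have hlB : ∀ b, (p kB).2 b = c₂ := const_of_classSym_replicate hkB
  obtain ⟨cs, hcs, hlC⟩ := oneOff_of_classSym_cons (fun h => (ne_of_lt h04) (by rw [h])) hkC
  exact parity_law_concave_rev heven hm d v ε c₀ c₂ c₃ (h01.trans h12) h23 as cs hlA (by rw [has]; exact h01) hlB hlC
    (hθ hAB') (hθ hBC') (hdom kA) (hdom kB) (hdom kC)

/-- **The exponents of the tight `(4,4)` cell admit no tight fifth class:** for `d = (0, 6, 15, 19, D)` with `D ≥ 64` (so that the
cheapest class-`4` histogram follows `{1}+3·{3}`), every unsigned dominant chain of a format-`(4,5)` design with these exponents has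
`n + 2 ≤ 70 = C(8,4)` (concave band: `6 + 2·19 = 44 ≤ 45 = 3·15`, `60 < 63 < D`).  The `(4,4)` cell itself is counting-tight on
`(0,6,15,19)` (`census_four_four_exact`, val-sym-lift-p1). [this cell] -/
theorem four_five_not_tight_0_6_15_19 (D : ℕ) (hD : 64 ≤ D) (v ε : Fin 4 → Fin 4 → Fin 5 → ℤ)
    {n : ℕ} (θ : Fin (n + 1) → ℤ) (p : Fin (n + 1) → Equiv.Perm (Fin 4) × (Fin 4 → Fin 5))
    (hθ : StrictMono θ) (hdom : ∀ k, IsDominant ![0, 6, 15, 19, D] v ε (θ k) (p k))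
    (hne : ∀ k : Fin n, p k.castSucc ≠ p k.succ) : n + 2 ≤ 70 := by
  have h := parity_census_concave (m := 4) (K := 5) ⟨2, rfl⟩ (by norm_num) ![0, 6, 15, 19, D] v ε 0 1 2 3 4
    (by simp) (by simp) (by simp) (by simp; omega) (by simp) (by simp) (by simp; omega) θ p hθ hdom hne
  have e : Nat.multichoose 5 4 = 70 := by rw [Nat.multichoose_eq]; decide
  omega

end Census

end Summit.ValiantsHypothesis.ValiantsHypothesis.Theorems.KPlusLogSqLaw.ParityLaw
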